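import Summits.NavierStokesRegularity.NavierStokesRegularity.Theorems.CoriolisHeadLocalEnergyRieszPressureBMO
import HarnessLib

/-!
# CoriolisHeadLocalEnergyRieszPressureDensity — crux `NoCoRotatingCore` (stmt-NavierStokesRegularity-22676), line
# `local_energy_rescue` (crux workfile v2.1, ns-idea-10 g3), stub S3a `stub_localEnergyClass`: THE CALDERÓN–ZYGMUND ROUND

`LocalEnergyRescue.exists_sq_oscillation_pressurePotentialMod_le_of_density`: the pressure oscillation INHERITS THE ENERGY DENSITY
EXPONENT.  There is a universal `κ ≥ 0` such that for every smooth field `u : ℝ³ → ℝ³` with `‖u‖ ≤ N` and sub-volume energy density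
`∫_{B(z,ρ)} ‖u‖² ≤ A ρ^{3−β}` (`ρ ≥ 1`, `0 ≤ β ≤ 3`), the Riesz pressure modulo constants satisfies, for `ρ ≥ 1`,

  `∫_{B(z,ρ)} (Q̃ − m)² ≤ κ (N² A + A²) ρ^{3−β}`,  `Q̃ = pressurePotentialMod x₀ u`.

Same split as `exists_sq_oscillation_pressurePotentialMod_le` (file `…RieszPressureBMO`, the case `β = 0`): at scale `R = ρ/2`,
`Q̃ = c + Q[w] + p₂` on `B̄(z,2R)` (`exists_pressurePotentialMod_split`); Stein's `L²` bound puts the near part under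
`κ₁² N² ∫ cutoff(8R)(z−·)‖u‖² ≤ κ₁² N² ∫_{B(z,17R)} ‖u‖² ≤ 17³ κ₁² N² A R^{3−β}`; the far oscillation is
`≤ 64 M R Σ_k (2^kR)⁻⁴ ∫ cutoff(2^{k+1}R)(z−·)‖u‖² ≤ 64 M R Σ_k (2^kR)⁻⁴ A (2^{k+3}R)^{3−β} ≤ 65536 M A R^{3−β}/R³`, whose square times
`|B(z,ρ)|` is `≲ M² A² ρ^{3−β}` for `ρ ≥ 1`.  This is the «CZ round» that S3a's card marks as load-bearing (with `β = 3/2` from S2 it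
gives `∫_{B_ρ}(P − m)² ≲ ρ^{3/2}`, the input of the linear-density round and of the `L^{3/2}(Q₁)` pressure bound).

HONEST FRAMING.  Potential theory of bounded fields; helper for an unregistered line; S3a, `NoCoRotatingCore` and NS regularity are NOT
proved.

References: L. Grafakos, *Modern Fourier Analysis*, 2nd ed. (2009), Thm 3.4.9 / Cor. 3.4.10 [GrafakosMFA2009]; G. Seregin (2014), §6.2
Lemma 6.5 [Seregin2014]; L. Caffarelli, R. Kohn, L. Nirenberg, CPAM 35 (1982), §2 [CaffarelliKohnNirenberg1982].
-/

noncomputable section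

open MeasureTheory Set Function Filter Topology Metric InnerProductSpace Real
open scoped RealInnerProductSpace ContDiff Topology

-- the crux's namespace is already a prefix of the route's; silence the duplicate-namespace linter as the sibling files do
set_option linter.dupNamespace false

-- nested operator types `ℝ³ →L[ℝ] ℝ³ →L[ℝ] ℝ³ →L[ℝ] ℝ`
set_option maxSynthPendingDepth 3

namespace Summit.NavierStokesRegularity.NavierStokesRegularity.Theorems.CoriolisHead

namespace LocalEnergyRescue

open Literature.Analysis Literature.Analysis.FluidPDE
open Summit.NavierStokesRegularity.NavierStokesRegularity.Theorems.PoloidalWindowDoorPoloidalWindowRigiditySparseEnergyPressureSplitNear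
open Summit.NavierStokesRegularity.NavierStokesRegularity.Theorems.PoloidalWindowDoorPoloidalWindowRigiditySparseEnergyPressureSplitFar
open Summit.NavierStokesRegularity.NavierStokesRegularity.Theorems.PoloidalWindowDoorPoloidalWindowRigiditySparseEnergyFarOscillation

/-- `c^{3−β} ≤ c³` for `c ≥ 1`, `0 ≤ β`. [folklore] -/
theorem rpow_three_sub_le_pow {c β : ℝ} (hc : 1 ≤ c) (hβ : 0 ≤ β) : c ^ (3 - β) ≤ c ^ 3 := by
  calc c ^ (3 - β) ≤ c ^ (3 : ℝ) := Real.rpow_le_rpow_of_exponent_le hc (by linarith)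
    _ = c ^ 3 := by rw [show (3 : ℝ) = ((3 : ℕ) : ℝ) by norm_num, Real.rpow_natCast]

/-- **The local energy under a cut-off is controlled by the density**: `∫ cutoff r (a − y) ‖u y‖² dy ≤ ∫_{B(a, 3r)} ‖u‖²`
(`0 ≤ cutoff ≤ 1`, `cutoff r (a − y) = 0` for `‖a − y‖ ≥ 2r`). [folklore] -/
theorem integral_cutoff_mul_norm_sq_le_setIntegral {u : EuclideanSpace ℝ (Fin 3) → EuclideanSpace ℝ (Fin 3)} (hu : Continuous u)
    {r : ℝ} (hr : 0 < r) (a : EuclideanSpace ℝ (Fin 3)) :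
    ∫ y, cutoff r (a - y) * ‖u y‖ ^ 2 ≤ ∫ y in ball a (3 * r), ‖u y‖ ^ 2 := by
  have hzero : ∀ y, y ∉ ball a (3 * r) → cutoff r (a - y) * ‖u y‖ ^ 2 = 0 := by
    intro y hy
    rw [mem_ball, dist_eq_norm, not_lt, ← norm_neg, neg_sub] at hy
    rw [cutoff_eq_zero hr (by linarith), zero_mul]
  rw [← setIntegral_eq_integral_of_forall_compl_eq_zero hzero]
  have hiu : IntegrableOn (fun y => ‖u y‖ ^ 2) (ball a (3 * r)) volume :=
    ((hu.norm.pow 2).continuousOn.integrableOn_compact (isCompact_closedBall a (3 * r))).mono_set ball_subset_closedBall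
  refine setIntegral_mono_on ((integrable_cutoff_mul_norm_sq hu hr a).integrableOn) hiu measurableSet_ball fun y _ => ?_
  calc cutoff r (a - y) * ‖u y‖ ^ 2 ≤ 1 * ‖u y‖ ^ 2 :=
        mul_le_mul_of_nonneg_right (cutoff_le_one _ _) (sq_nonneg _)
    _ = ‖u y‖ ^ 2 := one_mul _

/-- **The dyadic energies under a density bound**: if `∫_{B(z,ρ)} ‖u‖² ≤ A ρ^{3−β}` for `ρ ≥ 1` (`0 ≤ β`), then for `R ≥ 1/2`
`Σ'_k (2^kR)⁻⁴ ∫ cutoff(2^{k+1}R)(a−y)‖u y‖² dy ≤ 1024 A R^{3−β} / R⁴` (term `k` is `≤ (512 A R^{3−β}/R⁴) 2⁻ᵏ`). [folklore] -/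
theorem tsum_dyadicEnergy_le_of_density {u : EuclideanSpace ℝ (Fin 3) → EuclideanSpace ℝ (Fin 3)} (hu : Continuous u) {N : ℝ}
    (hN : ∀ y, ‖u y‖ ≤ N) {A β : ℝ} (hβ : 0 ≤ β)
    (hA : ∀ (z : EuclideanSpace ℝ (Fin 3)) (ρ : ℝ), 1 ≤ ρ → ∫ y in ball z ρ, ‖u y‖ ^ 2 ≤ A * ρ ^ (3 - β))
    {R : ℝ} (hR : 1 / 2 ≤ R) (a : EuclideanSpace ℝ (Fin 3)) :
    ∑' k : ℕ, ((2 : ℝ) ^ k * R)⁻¹ ^ 4 * ∫ y, cutoff ((2 : ℝ) ^ (k + 1) * R) (a - y) * ‖u y‖ ^ 2 ≤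
      1024 * A * R ^ (3 - β) / R ^ 4 := by
  have hRpos : 0 < R := by linarith
  have hA0 : 0 ≤ A := by
    have h := hA a 1 le_rfl
    have h0 : 0 ≤ ∫ y in ball a 1, ‖u y‖ ^ 2 := integral_nonneg fun y => sq_nonneg _
    rw [Real.one_rpow, mul_one] at h
    linarith
  set S : ℝ := R ^ (3 - β) with hS
  have hS0 : 0 ≤ S := Real.rpow_nonneg hRpos.le _
  have hterm : ∀ k : ℕ, ((2 : ℝ) ^ k * R)⁻¹ ^ 4 * ∫ y, cutoff ((2 : ℝ) ^ (k + 1) * R) (a - y) * ‖u y‖ ^ 2 ≤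
      (512 * A * S / R ^ 4) * (1 / 2) ^ k := by
    intro k
    have h2k : 0 < (2 : ℝ) ^ k := pow_pos two_pos k
    have hρ : 0 < (2 : ℝ) ^ (k + 1) * R := by positivity
    -- `∫ cutoff ‖u‖² ≤ ∫_{B(a, 3·2^{k+1}R)} ‖u‖² ≤ A (3·2^{k+1}R)^{3−β} ≤ A (3·2^{k+1})³ S`
    have hrad : 1 ≤ 3 * ((2 : ℝ) ^ (k + 1) * R) := by
      have : (1 : ℝ) ≤ 2 ^ (k + 1) := one_le_pow₀ (by norm_num)
      nlinarith
    have h1 : ∫ y, cutoff ((2 : ℝ) ^ (k + 1) * R) (a - y) * ‖u y‖ ^ 2 ≤ A * ((3 * 2 ^ (k + 1)) ^ 3 * S) := by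
      calc ∫ y, cutoff ((2 : ℝ) ^ (k + 1) * R) (a - y) * ‖u y‖ ^ 2
          ≤ ∫ y in ball a (3 * ((2 : ℝ) ^ (k + 1) * R)), ‖u y‖ ^ 2 := integral_cutoff_mul_norm_sq_le_setIntegral hu hρ a
        _ ≤ A * (3 * ((2 : ℝ) ^ (k + 1) * R)) ^ (3 - β) := hA a _ hrad
        _ = A * ((3 * 2 ^ (k + 1)) ^ (3 - β) * S) := by
            rw [show 3 * ((2 : ℝ) ^ (k + 1) * R) = (3 * 2 ^ (k + 1)) * R by ring,
              Real.mul_rpow (by positivity) hRpos.le]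
        _ ≤ A * ((3 * 2 ^ (k + 1)) ^ 3 * S) := by
            have h1le : (1 : ℝ) ≤ 3 * 2 ^ (k + 1) := by
              have : (1 : ℝ) ≤ 2 ^ (k + 1) := one_le_pow₀ (by norm_num)
              linarith
            exact mul_le_mul_of_nonneg_left (mul_le_mul_of_nonneg_right (rpow_three_sub_le_pow h1le hβ) hS0) hA0
    calc ((2 : ℝ) ^ k * R)⁻¹ ^ 4 * ∫ y, cutoff ((2 : ℝ) ^ (k + 1) * R) (a - y) * ‖u y‖ ^ 2
        ≤ ((2 : ℝ) ^ k * R)⁻¹ ^ 4 * (A * ((3 * 2 ^ (k + 1)) ^ 3 * S)) :=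
          mul_le_mul_of_nonneg_left h1 (by positivity)
      _ = (216 * A * S / R ^ 4) * (1 / 2) ^ k := by
          rw [one_div_pow, pow_succ]
          field_simp
          ring
      _ ≤ (512 * A * S / R ^ 4) * (1 / 2) ^ k := by
          apply mul_le_mul_of_nonneg_right _ (by positivity)
          apply div_le_div_of_nonneg_right _ (by positivity)
          have := mul_nonneg hA0 hS0
          linarith
  have hgeo : Summable fun k : ℕ => (512 * A * S / R ^ 4) * (1 / 2 : ℝ) ^ k :=
    (summable_geometric_of_lt_one (by norm_num) (by norm_num)).mul_left _
  calc ∑' k : ℕ, ((2 : ℝ) ^ k * R)⁻¹ ^ 4 * ∫ y, cutoff ((2 : ℝ) ^ (k + 1) * R) (a - y) * ‖u y‖ ^ 2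
      ≤ ∑' k : ℕ, (512 * A * S / R ^ 4) * (1 / 2 : ℝ) ^ k :=
        (summable_dyadicEnergy hN hRpos a).tsum_le_tsum hterm hgeo
    _ = (512 * A * S / R ^ 4) * 2 := by rw [tsum_mul_left, tsum_geometric_two]
    _ = 1024 * A * R ^ (3 - β) / R ^ 4 := by rw [hS]; ring

/-- **The Calderón–Zygmund round: the pressure oscillation inherits the energy density exponent.**  There is `κ ≥ 0` such that for
every smooth `u : ℝ³ → ℝ³` with `‖u‖ ≤ N` and `∫_{B(z,ρ)} ‖u‖² ≤ A ρ^{3−β}` for all `ρ ≥ 1` (`0 ≤ β ≤ 3`), every base point `x₀`,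
centre `z` and radius `ρ ≥ 1`: `∫_{B(z,ρ)} (pressurePotentialMod x₀ u y − m)² dy ≤ κ (N² A + A²) ρ^{3−β}` for some `m`.
[cite: GrafakosMFA2009, Theorem 3.4.9 and Corollary 3.4.10] [cite: Seregin2014, §6.2 Lemma 6.5] -/
theorem exists_sq_oscillation_pressurePotentialMod_le_of_density :
    ∃ κ : ℝ, 0 ≤ κ ∧ ∀ (u : EuclideanSpace ℝ (Fin 3) → EuclideanSpace ℝ (Fin 3)) (N : ℝ),
      ContDiff ℝ ∞ u → (∀ y, ‖u y‖ ≤ N) → ∀ (A β : ℝ), 0 ≤ β → β ≤ 3 →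
      (∀ (z : EuclideanSpace ℝ (Fin 3)) (ρ : ℝ), 1 ≤ ρ → ∫ y in ball z ρ, ‖u y‖ ^ 2 ≤ A * ρ ^ (3 - β)) →
      ∀ (x₀ z : EuclideanSpace ℝ (Fin 3)) (ρ : ℝ), 1 ≤ ρ →
        ∃ m : ℝ, ∫ y in ball z ρ, (pressurePotentialMod x₀ u y - m) ^ 2 ≤ κ * (N ^ 2 * A + A ^ 2) * ρ ^ (3 - β) := by
  obtain ⟨κ₁, hκ₁0, hnear⟩ := exists_sqrt_setIntegral_sq_pressurePotential_cutField_le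
  obtain ⟨M, hM0, hM⟩ := exists_norm_fderiv3_newtonKernel_le
  set V : ℝ := (volume : Measure (EuclideanSpace ℝ (Fin 3))).real (ball 0 1) with hV
  have hV0 : 0 ≤ V := measureReal_nonneg
  refine ⟨2 * 13824 * κ₁ ^ 2 + 2 * 64 * (65536 * M) ^ 2 * V, by positivity,
    fun u N hu hN A β hβ0 hβ3 hA x₀ z ρ hρ1 => ?_⟩
  have hρ : 0 < ρ := by linarith
  have hN0 : 0 ≤ N := (norm_nonneg _).trans (hN 0)
  have hA0 : 0 ≤ A := by
    have h := hA z 1 le_rfl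
    have h0 : 0 ≤ ∫ y in ball z 1, ‖u y‖ ^ 2 := integral_nonneg fun y => sq_nonneg _
    rw [Real.one_rpow, mul_one] at h
    linarith
  -- the split at scale `R = ρ / 2`
  set R : ℝ := ρ / 2 with hRdef
  have hR : 0 < R := by positivity
  have hRhalf : 1 / 2 ≤ R := by rw [hRdef]; linarith
  have h2R : 2 * R = ρ := by rw [hRdef]; ring
  set S : ℝ := R ^ (3 - β) with hS
  set T : ℝ := ρ ^ (3 - β) with hT
  have hS0 : 0 ≤ S := Real.rpow_nonneg hR.le _
  have hT0 : 0 ≤ T := Real.rpow_nonneg hρ.le _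
  have hST : S ≤ T := Real.rpow_le_rpow hR.le (by rw [hRdef]; linarith) (by linarith)
  have hT3 : T ≤ ρ ^ 3 := rpow_three_sub_le_pow hρ1 hβ0
  obtain ⟨c, hc⟩ := exists_pressurePotentialMod_split hR hu hN z x₀
  obtain ⟨hQi, hQle⟩ := hnear u N hu hN z R hR
  have hfar : ∀ {x y : EuclideanSpace ℝ (Fin 3)}, x ∈ closedBall z (2 * R) → y ∈ closedBall z (2 * R) →
      |(farPotential (R * 1) (R * 2) (fun y => cutoff (4 * R) (z - y) • u y) x - farPotentialMod (R * 1) (R * 2) x₀ u x) -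
        (farPotential (R * 1) (R * 2) (fun y => cutoff (4 * R) (z - y) • u y) y - farPotentialMod (R * 1) (R * 2) x₀ u y)| ≤
      64 * M * R * ∑' k : ℕ, ((2 : ℝ) ^ k * R)⁻¹ ^ 4 * ∫ y, cutoff ((2 : ℝ) ^ (k + 1) * R) (z - y) * ‖u y‖ ^ 2 :=
    fun hx hy => abs_farSplit_sub_le (r₀ := R * 1) (r₁ := R * 2) (by positivity) (by nlinarith) hR (by nlinarith)
      hu.continuous hN z x₀ hM0 hM hx hy
  set w : EuclideanSpace ℝ (Fin 3) → EuclideanSpace ℝ (Fin 3) := fun y => cutoff (4 * R) (z - y) • u y with hw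
  set p₂ : EuclideanSpace ℝ (Fin 3) → ℝ := fun x =>
    farPotential (R * 1) (R * 2) w x - farPotentialMod (R * 1) (R * 2) x₀ u x with hp₂
  -- the near part: `∫_{B̄(z,2R)} Q[w]² ≤ κ₁² N² ∫_{B(z, 24R)} ‖u‖² ≤ κ₁² N² A (24R)^{3−β} ≤ 13824 κ₁² N² A S`
  have hcut : ∫ x, cutoff (8 * R) (z - x) * ‖u x‖ ^ 2 ≤ A * (13824 * S) := by
    have hrad : 1 ≤ 3 * (8 * R) := by linarith
    calc ∫ x, cutoff (8 * R) (z - x) * ‖u x‖ ^ 2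
        ≤ ∫ x in ball z (3 * (8 * R)), ‖u x‖ ^ 2 := integral_cutoff_mul_norm_sq_le_setIntegral hu.continuous (by positivity) z
      _ ≤ A * (3 * (8 * R)) ^ (3 - β) := hA z _ hrad
      _ = A * ((24 : ℝ) ^ (3 - β) * S) := by
          rw [show 3 * (8 * R) = (24 : ℝ) * R by ring, Real.mul_rpow (by norm_num) hR.le]
      _ ≤ A * (13824 * S) := by
          apply mul_le_mul_of_nonneg_left _ hA0
          have h24 : (24 : ℝ) ^ (3 - β) ≤ 24 ^ 3 := rpow_three_sub_le_pow (by norm_num) hβ0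
          nlinarith
  have hQ2 : ∫ x in closedBall z (2 * R), (pressurePotential w x) ^ 2 ≤ 13824 * κ₁ ^ 2 * N ^ 2 * A * S := by
    have h0 : 0 ≤ ∫ x in closedBall z (2 * R), (pressurePotential w x) ^ 2 :=
      integral_nonneg fun x => sq_nonneg _
    have h1 : ∫ x in closedBall z (2 * R), (pressurePotential w x) ^ 2 ≤
        (κ₁ * N * Real.sqrt (∫ x, cutoff (8 * R) (z - x) * ‖u x‖ ^ 2)) ^ 2 := by
      rw [← Real.sq_sqrt h0]
      exact pow_le_pow_left₀ (Real.sqrt_nonneg _) hQle 2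
    have hI0 : 0 ≤ ∫ x, cutoff (8 * R) (z - x) * ‖u x‖ ^ 2 :=
      integral_nonneg fun x => mul_nonneg (cutoff_nonneg _ _) (sq_nonneg _)
    calc ∫ x in closedBall z (2 * R), (pressurePotential w x) ^ 2
        ≤ (κ₁ * N) ^ 2 * ∫ x, cutoff (8 * R) (z - x) * ‖u x‖ ^ 2 := by
          rw [mul_pow, Real.sq_sqrt hI0] at h1; exact h1
      _ ≤ (κ₁ * N) ^ 2 * (A * (13824 * S)) := mul_le_mul_of_nonneg_left hcut (sq_nonneg _)
      _ = 13824 * κ₁ ^ 2 * N ^ 2 * A * S := by ring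
  have hQball : ∫ y in ball z ρ, (pressurePotential w y) ^ 2 ≤ 13824 * κ₁ ^ 2 * N ^ 2 * A * S := by
    calc ∫ y in ball z ρ, (pressurePotential w y) ^ 2
        ≤ ∫ y in closedBall z (2 * R), (pressurePotential w y) ^ 2 := by
          rw [h2R]
          exact setIntegral_mono_set hQi.integrableOn (ae_of_all _ fun y => sq_nonneg _)
            ball_subset_closedBall.eventuallyLE
      _ ≤ 13824 * κ₁ ^ 2 * N ^ 2 * A * S := hQ2
  -- the oscillation of the harmonic remainder on `B̄(z, 2R)`: `≤ 65536 M A S / R³`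
  have hT' := tsum_dyadicEnergy_le_of_density hu.continuous hN hβ0 hA hRhalf z
  set O : ℝ := 65536 * M * A * S / R ^ 3 with hO
  have hO0 : 0 ≤ O := by positivity
  have hosc : ∀ x ∈ closedBall z (2 * R), |p₂ x - p₂ z| ≤ O := by
    intro x hx
    have hz : z ∈ closedBall z (2 * R) := mem_closedBall_self (by positivity)
    have h := hfar hx hz
    calc |p₂ x - p₂ z| ≤ 64 * M * R *
          ∑' k : ℕ, ((2 : ℝ) ^ k * R)⁻¹ ^ 4 * ∫ y, cutoff ((2 : ℝ) ^ (k + 1) * R) (z - y) * ‖u y‖ ^ 2 := h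
      _ ≤ 64 * M * R * (1024 * A * R ^ (3 - β) / R ^ 4) := mul_le_mul_of_nonneg_left hT' (by positivity)
      _ = O := by rw [hO, hS]; field_simp; ring
  -- pointwise on the ball
  set m : ℝ := c + p₂ z with hm
  have hpt : ∀ y ∈ ball z ρ, (pressurePotentialMod x₀ u y - m) ^ 2 ≤ 2 * (pressurePotential w y) ^ 2 + 2 * O ^ 2 := by
    intro y hy
    have hy' : y ∈ closedBall z (2 * R) := by rw [h2R]; exact ball_subset_closedBall hy
    have e : pressurePotentialMod x₀ u y - m = pressurePotential w y + (p₂ y - p₂ z) := by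
      rw [hc y hy', hm]; ring
    rw [e]
    have h1 : (p₂ y - p₂ z) ^ 2 ≤ O ^ 2 := by
      have := hosc y hy'
      rw [← sq_abs]
      exact pow_le_pow_left₀ (abs_nonneg _) this 2
    nlinarith [sq_nonneg (pressurePotential w y - (p₂ y - p₂ z))]
  -- integrate
  have hQc : Continuous (pressurePotentialMod x₀ u) := continuous_pressurePotentialMod (contDiff_infty.1 hu 2) hN x₀
  have hli : IntegrableOn (fun y => (pressurePotentialMod x₀ u y - m) ^ 2) (ball z ρ) volume :=
    (((hQc.sub continuous_const).pow 2).continuousOn.integrableOn_compact (isCompact_closedBall z ρ)).mono_set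
      ball_subset_closedBall
  have hci : IntegrableOn (fun _ : EuclideanSpace ℝ (Fin 3) => 2 * O ^ 2) (ball z ρ) volume :=
    integrableOn_const (measure_ball_lt_top.ne)
  have hQi2 : IntegrableOn (fun y => 2 * (pressurePotential w y) ^ 2) (ball z ρ) volume :=
    (hQi.const_mul 2).integrableOn
  have hri : IntegrableOn (fun y => 2 * (pressurePotential w y) ^ 2 + 2 * O ^ 2) (ball z ρ) volume := hQi2.add hci
  have hvol : volume.real (ball z ρ) = ρ ^ 3 * V := by
    rw [hV, measureReal_def, measureReal_def, Measure.addHaar_ball volume z hρ.le, finrank_euclideanSpace_fin,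
      ENNReal.toReal_mul, ENNReal.toReal_ofReal (by positivity)]
  have hsplit : ∫ y in ball z ρ, (2 * (pressurePotential w y) ^ 2 + 2 * O ^ 2) =
      2 * (∫ y in ball z ρ, (pressurePotential w y) ^ 2) + 2 * O ^ 2 * (ρ ^ 3 * V) := by
    rw [integral_add hQi2 hci, integral_const_mul, setIntegral_const, smul_eq_mul, hvol]
    ring
  -- the far term in terms of `T = ρ^{3−β}`: `O² ρ³ = 65536² M² A² S² 64 / ρ³ ≤ 64 · 65536² M² A² T`
  have hfarT : O ^ 2 * (ρ ^ 3 * V) ≤ 64 * (65536 * M) ^ 2 * V * A ^ 2 * T := by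
    have hR3 : R ^ 3 = ρ ^ 3 / 8 := by rw [hRdef]; ring
    have hρ3 : 0 < ρ ^ 3 := pow_pos hρ 3
    have e : O ^ 2 * (ρ ^ 3 * V) = 64 * (65536 * M) ^ 2 * V * A ^ 2 * (S * S / ρ ^ 3) := by
      rw [hO, hR3]; field_simp; ring
    rw [e]
    have hSS : S * S / ρ ^ 3 ≤ T := by
      rw [div_le_iff₀ hρ3]
      calc S * S ≤ T * ρ ^ 3 := mul_le_mul hST (hST.trans hT3) hS0 hT0
        _ = T * ρ ^ 3 := rfl
    exact mul_le_mul_of_nonneg_left hSS (by positivity)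
  refine ⟨m, ?_⟩
  calc ∫ y in ball z ρ, (pressurePotentialMod x₀ u y - m) ^ 2
      ≤ ∫ y in ball z ρ, (2 * (pressurePotential w y) ^ 2 + 2 * O ^ 2) :=
        setIntegral_mono_on hli hri measurableSet_ball hpt
    _ = 2 * (∫ y in ball z ρ, (pressurePotential w y) ^ 2) + 2 * O ^ 2 * (ρ ^ 3 * V) := hsplit
    _ ≤ 2 * (13824 * κ₁ ^ 2 * N ^ 2 * A * S) + 2 * (64 * (65536 * M) ^ 2 * V * A ^ 2 * T) := by
        linarith [hQball, hfarT]
    _ ≤ 2 * (13824 * κ₁ ^ 2 * N ^ 2 * A * T) + 2 * (64 * (65536 * M) ^ 2 * V * A ^ 2 * T) := by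
        have : 13824 * κ₁ ^ 2 * N ^ 2 * A * S ≤ 13824 * κ₁ ^ 2 * N ^ 2 * A * T :=
          mul_le_mul_of_nonneg_left hST (by positivity)
        linarith
    _ = (2 * 13824 * κ₁ ^ 2 + 2 * 64 * (65536 * M) ^ 2 * V) * (N ^ 2 * A + A ^ 2) * T
          - (2 * 13824 * κ₁ ^ 2 * (A ^ 2 * T) + 2 * 64 * (65536 * M) ^ 2 * V * (N ^ 2 * A * T)) := by ring
    _ ≤ (2 * 13824 * κ₁ ^ 2 + 2 * 64 * (65536 * M) ^ 2 * V) * (N ^ 2 * A + A ^ 2) * T := by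
        have h1 : 0 ≤ 2 * 13824 * κ₁ ^ 2 * (A ^ 2 * T) := by positivity
        have h2 : 0 ≤ 2 * 64 * (65536 * M) ^ 2 * V * (N ^ 2 * A * T) := by positivity
        linarith

end LocalEnergyRescue

end Summit.NavierStokesRegularity.NavierStokesRegularity.Theorems.CoriolisHead

end
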